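import Summits.AtomisticToContinuum.Crystallization.Theorems.FrustratedLawDichotomyTextureLift
import Summits.AtomisticToContinuum.Crystallization.Theorems.FrustratedLawDichotomySignedLedgerTextureDoor

/-!
# FrustratedLawDichotomy · residual crux `AperiodicFrustratedLawGap` (stmt-AtomisticToContinuum-27623) — THE NET ASSEMBLY
# (E′ ⟸ `hdef` alone, for a verdicted host net; decomp-a2c lens-5 g111 NODE-8; critic r1718 (C)(i) «DRIFT IS MOOT», confirmed and typed)

The texture door #56 `…SignedLedgerTextureDoor.aperiodicFrustratedLawGap_of_texture_and_defectDensity (C) (hC) (htex) (hdef)` reduces the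
crux to two hypotheses on a family of measurable root-local coherence classes `C δ`.  For the class of record
`C δ := ⋃ k, coherentAt (net δ k) (τ δ) (Rc δ)` — roots whose `Rc`-window is `τ`-coherent with SOME member of a host net every member of
which is VERDICTED WITH MARGIN (GOOD package `hG` or BAD soft certificates `hB` at every site of the inner window, covering radius `hcv`; the
data may depend on the hard-core parameter `δ`, as they must since `2τ < δ`) — the LIFT (198) `…TextureLift.ae_exists_incoherent_reroot_of_net`
PROVES `htex` from the residual's own hard-core and texture clauses.  Hence:

* `not_ae_forall_reroot_mem_of_net` — for a non-zero law a.s. rooted `δ`-hard-core and textured (`ApprM _ R₇ R₈ R₉` a.s.) it is FALSE that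
  almost surely every atom's re-rooting lies in `⋃ k, coherentAt (net k) τ Rc`; `not_ae_forall_reroot_mem_coherentAt_of_net` — a fortiori for
  one member.  These are exactly the premisses of the common-host regime (`hcommon k`) and of the drift regime (`hcover`) of the three-regime
  door (190) `…CoherentDriftDoor.nonempty_lawLedger_of_commonHost_or_drift`: for a verdicted net both regimes are EMPTY and the three-regime door
  collapses to the two-regime door #54/#56.
* ★ `aperiodicFrustratedLawGap_of_net_and_defectDensity` — THE CRUX BY NAME from the net data and `hdef` ALONE, `hdef` being #56's second
  hypothesis VERBATIM with `C δ` the union above: a law ledger for every ergodic admissible minimising law giving positive mass to roots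
  incoherent with every member (`0 < P.real (⋃ k, coherentAt (net δ k) (τ δ) (Rc δ))ᶜ`);
  `periodicChargeSplit_aperiodicFrustratedLawGap_of_net_and_defectDensity` — the `PeriodicChargeSplit` copy.
* the ONE-NET version of record (no `δ`-dependence, hard core upgraded to `7/10`) is ALREADY IN THE TREE as
  `…SignedLedgerNetDoor.aperiodicFrustratedLawGap_of_netData_and_defectDensity` (+ `PeriodicChargeSplit` copy; hand-2 #62, p858473) —
  statement-identical to this node's `…_of_constNet_…` pair, which the landing lane therefore DROPPED here (gate `dedup.landed`); cite the tree.

DEF-FREE; conclusions are the route decls by name; no radius of the crux is constrained (the LIFT chooses its radii after `R₈, R₉`).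
[folklore: junction]
-/

noncomputable section

namespace Summit.AtomisticToContinuum.Crystallization.Theorems.FrustratedLawDichotomyTextureNetAssembly

open MeasureTheory Metric Set
open scoped ENNReal
open Literature.Probability.Process Literature.Geometry.DiscreteGeometry
open Summit.AtomisticToContinuum.Crystallization.Theorems.FrustratedLawDichotomySignedLedger (LawLedger)
open Summit.AtomisticToContinuum.Crystallization.Theorems.RepetitiveNetworkReductionRecurrentMember (ApprM)
open Summit.AtomisticToContinuum.Crystallization.Theorems.FrustratedLawDichotomyCoherentSets (coherentAt measurableSet_iUnion_coherentAt)
open Summit.AtomisticToContinuum.Crystallization.Theorems.FrustratedLawDichotomyTextureLift (ae_exists_incoherent_reroot_of_net)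
open Summit.AtomisticToContinuum.Crystallization.Theorems.FrustratedLawDichotomySignedLedgerTextureDoor
  (aperiodicFrustratedLawGap_of_texture_and_defectDensity periodicChargeSplit_aperiodicFrustratedLawGap_of_texture_and_defectDensity)

/-- **The everywhere-coherent regimes are EMPTY for a verdicted net.**  A non-zero law, a.s. rooted `δ`-hard-core and textured, is NOT
almost surely coherent at every atom with some member of a verdicted net: the LIFT (198) gives a.s. an incoherent atom
(= ¬ `hcover` of (190)). [folklore] -/
theorem not_ae_forall_reroot_mem_of_net
    {δ : ℝ} {P : Measure (Measure (EuclideanSpace ℝ (Fin 3)))} (hP : P ≠ 0)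
    (hcore : ∀ᵐ μ ∂P, IsRootedHardCore δ μ) {R₇ R₈ R₉ : ℝ} (happr : ∀ᵐ μ ∂P, ApprM μ R₇ R₈ R₉)
    {τ Rc D σ h c ε : ℝ} (hτ : 0 ≤ τ) (h2τ : 2 * τ < δ) (hh : 0 < h) (hc : 0 ≤ c) (hLRc : h + 2 * c ≤ Rc) (hD : 0 ≤ D)
    (hε0 : 0 < ε) (hεδ : 8 * ε < δ) (hε7 : 8 * ε < 7 / 10) (hσ : 0 < σ) (h4ε : 4 * ε ≤ σ)
    {ι : Type*} (net : ι → Finset (EuclideanSpace ℝ (Fin 3))) (good : ι → Prop)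
    (hG : ∀ k : ι, good k → ∀ x ∈ net k, ‖x‖ ≤ h + 2 * c + τ →
      ∃ (A : EuclideanSpace ℝ (Fin 3) →ₗᵢ[ℝ] EuclideanSpace ℝ (Fin 3)) (d₀ η₀ γ₀ : ℝ), 0 < d₀ ∧ 0 ≤ η₀ ∧
        (∀ z ∈ net k, z ≠ x → d₀ ≤ dist z x) ∧ (∃ z ∈ net k, z ≠ x ∧ dist z x ≤ d₀) ∧
        η₀ * d₀ + 4 * τ < 1 / 8 * (d₀ - 2 * τ) ∧ 46 / 10 * τ < γ₀ ∧ ‖x‖ + 13 / 10 * d₀ + γ₀ + 4 * τ ≤ Rc ∧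
        80 * ε ≤ d₀ - 34 * τ - 8 * (η₀ * d₀) ∧ 10 * ε ≤ γ₀ - 46 / 10 * τ ∧ 2 * d₀ + γ₀ + 2 ≤ D ∧
        ((∃ t₀ : ↥fccKissingPattern → EuclideanSpace ℝ (Fin 3),
            (∀ u : ↥fccKissingPattern, t₀ u ∈ net k ∧ ‖(t₀ u - x) - d₀ • A (u : EuclideanSpace ℝ (Fin 3))‖ ≤ η₀ * d₀) ∧
            (∀ z ∈ net k, z ≠ x → dist z x < 13 / 10 * d₀ + γ₀ → dist z x ≤ 13 / 10 * d₀ - γ₀ ∧ z ∈ Set.range t₀)) ∨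
         (∃ t₀ : ↥hcpKissingPattern → EuclideanSpace ℝ (Fin 3),
            (∀ u : ↥hcpKissingPattern, t₀ u ∈ net k ∧ ‖(t₀ u - x) - d₀ • A (u : EuclideanSpace ℝ (Fin 3))‖ ≤ η₀ * d₀) ∧
            (∀ z ∈ net k, z ≠ x → dist z x < 13 / 10 * d₀ + γ₀ → dist z x ≤ 13 / 10 * d₀ - γ₀ ∧ z ∈ Set.range t₀))))
    (hB : ∀ k : ι, ¬ good k → (∀ z ∈ net k, ∀ z' ∈ net k, z ≠ z' → 2 * τ < dist z z') ∧
      ∀ x ∈ net k, ‖x‖ ≤ h + 2 * c + τ → ∃ (z₁ : EuclideanSpace ℝ (Fin 3)) (d₁ : ℝ), z₁ ∈ net k ∧ z₁ ≠ x ∧ dist z₁ x ≤ d₁ ∧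
        23 / 10 * (d₁ + 2 * τ + 2 * ε) + 1 ≤ D ∧ ‖x‖ + τ + 9 / 8 * (d₁ + 2 * τ + 2 * ε) + σ ≤ Rc ∧
        (∀ dk : ℝ, (7 : ℝ) / 10 ≤ dk → ∀ A : EuclideanSpace ℝ (Fin 3) →ₗᵢ[ℝ] EuclideanSpace ℝ (Fin 3),
          ¬ ((∀ u ∈ fccKissingPattern, ∃ z ∈ net k, dist (z - x) (dk • A u) ≤ dk / 8 + σ + 2 * τ) ∧
              (∀ z ∈ net k, z ≠ x → dist z x + σ + 4 * τ ≤ 13 / 10 * dk →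
                ∃ u ∈ fccKissingPattern, dist (z - x) (dk • A u) ≤ dk / 8 + σ + 2 * τ))) ∧
        (∀ dk : ℝ, (7 : ℝ) / 10 ≤ dk → ∀ A : EuclideanSpace ℝ (Fin 3) →ₗᵢ[ℝ] EuclideanSpace ℝ (Fin 3),
          ¬ ((∀ u ∈ hcpKissingPattern, ∃ z ∈ net k, dist (z - x) (dk • A u) ≤ dk / 8 + σ + 2 * τ) ∧
              (∀ z ∈ net k, z ≠ x → dist z x + σ + 4 * τ ≤ 13 / 10 * dk →
                ∃ u ∈ hcpKissingPattern, dist (z - x) (dk • A u) ≤ dk / 8 + σ + 2 * τ))))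
    (hcv : ∀ k : ι, ∀ w : EuclideanSpace ℝ (Fin 3), ‖w‖ ≤ h + c → ∃ z ∈ net k, dist w z ≤ c - τ) :
    ¬ (∀ᵐ μ ∂P, ∀ p : EuclideanSpace ℝ (Fin 3), μ {p} ≠ 0 →
        ∃ k : ι, Measure.map (fun z : EuclideanSpace ℝ (Fin 3) => z - p) μ ∈ coherentAt (net k) τ Rc) := by
  intro hall
  have hex := ae_exists_incoherent_reroot_of_net hcore happr hτ h2τ hh hc hLRc hD hε0 hεδ hε7 hσ h4ε net good hG hB hcv
  have hfalse : ∀ᵐ μ ∂P, False := by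
    filter_upwards [hall, hex] with μ h1 h2
    obtain ⟨p, hp, hnot⟩ := h2
    exact hnot (Set.mem_iUnion.mpr (h1 p hp))
  rw [ae_iff] at hfalse
  simp only [not_false_eq_true, Set.setOf_true] at hfalse
  exact hP (Measure.measure_univ_eq_zero.mp hfalse)

/-- A fortiori NO single member hosts almost every atom (= ¬ the premiss of `hcommon k` of (190)). [folklore] -/
theorem not_ae_forall_reroot_mem_coherentAt_of_net
    {δ : ℝ} {P : Measure (Measure (EuclideanSpace ℝ (Fin 3)))} (hP : P ≠ 0)
    (hcore : ∀ᵐ μ ∂P, IsRootedHardCore δ μ) {R₇ R₈ R₉ : ℝ} (happr : ∀ᵐ μ ∂P, ApprM μ R₇ R₈ R₉)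
    {τ Rc D σ h c ε : ℝ} (hτ : 0 ≤ τ) (h2τ : 2 * τ < δ) (hh : 0 < h) (hc : 0 ≤ c) (hLRc : h + 2 * c ≤ Rc) (hD : 0 ≤ D)
    (hε0 : 0 < ε) (hεδ : 8 * ε < δ) (hε7 : 8 * ε < 7 / 10) (hσ : 0 < σ) (h4ε : 4 * ε ≤ σ)
    {ι : Type*} (net : ι → Finset (EuclideanSpace ℝ (Fin 3))) (good : ι → Prop)
    (hG : ∀ k : ι, good k → ∀ x ∈ net k, ‖x‖ ≤ h + 2 * c + τ →
      ∃ (A : EuclideanSpace ℝ (Fin 3) →ₗᵢ[ℝ] EuclideanSpace ℝ (Fin 3)) (d₀ η₀ γ₀ : ℝ), 0 < d₀ ∧ 0 ≤ η₀ ∧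
        (∀ z ∈ net k, z ≠ x → d₀ ≤ dist z x) ∧ (∃ z ∈ net k, z ≠ x ∧ dist z x ≤ d₀) ∧
        η₀ * d₀ + 4 * τ < 1 / 8 * (d₀ - 2 * τ) ∧ 46 / 10 * τ < γ₀ ∧ ‖x‖ + 13 / 10 * d₀ + γ₀ + 4 * τ ≤ Rc ∧
        80 * ε ≤ d₀ - 34 * τ - 8 * (η₀ * d₀) ∧ 10 * ε ≤ γ₀ - 46 / 10 * τ ∧ 2 * d₀ + γ₀ + 2 ≤ D ∧
        ((∃ t₀ : ↥fccKissingPattern → EuclideanSpace ℝ (Fin 3),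
            (∀ u : ↥fccKissingPattern, t₀ u ∈ net k ∧ ‖(t₀ u - x) - d₀ • A (u : EuclideanSpace ℝ (Fin 3))‖ ≤ η₀ * d₀) ∧
            (∀ z ∈ net k, z ≠ x → dist z x < 13 / 10 * d₀ + γ₀ → dist z x ≤ 13 / 10 * d₀ - γ₀ ∧ z ∈ Set.range t₀)) ∨
         (∃ t₀ : ↥hcpKissingPattern → EuclideanSpace ℝ (Fin 3),
            (∀ u : ↥hcpKissingPattern, t₀ u ∈ net k ∧ ‖(t₀ u - x) - d₀ • A (u : EuclideanSpace ℝ (Fin 3))‖ ≤ η₀ * d₀) ∧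
            (∀ z ∈ net k, z ≠ x → dist z x < 13 / 10 * d₀ + γ₀ → dist z x ≤ 13 / 10 * d₀ - γ₀ ∧ z ∈ Set.range t₀))))
    (hB : ∀ k : ι, ¬ good k → (∀ z ∈ net k, ∀ z' ∈ net k, z ≠ z' → 2 * τ < dist z z') ∧
      ∀ x ∈ net k, ‖x‖ ≤ h + 2 * c + τ → ∃ (z₁ : EuclideanSpace ℝ (Fin 3)) (d₁ : ℝ), z₁ ∈ net k ∧ z₁ ≠ x ∧ dist z₁ x ≤ d₁ ∧
        23 / 10 * (d₁ + 2 * τ + 2 * ε) + 1 ≤ D ∧ ‖x‖ + τ + 9 / 8 * (d₁ + 2 * τ + 2 * ε) + σ ≤ Rc ∧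
        (∀ dk : ℝ, (7 : ℝ) / 10 ≤ dk → ∀ A : EuclideanSpace ℝ (Fin 3) →ₗᵢ[ℝ] EuclideanSpace ℝ (Fin 3),
          ¬ ((∀ u ∈ fccKissingPattern, ∃ z ∈ net k, dist (z - x) (dk • A u) ≤ dk / 8 + σ + 2 * τ) ∧
              (∀ z ∈ net k, z ≠ x → dist z x + σ + 4 * τ ≤ 13 / 10 * dk →
                ∃ u ∈ fccKissingPattern, dist (z - x) (dk • A u) ≤ dk / 8 + σ + 2 * τ))) ∧
        (∀ dk : ℝ, (7 : ℝ) / 10 ≤ dk → ∀ A : EuclideanSpace ℝ (Fin 3) →ₗᵢ[ℝ] EuclideanSpace ℝ (Fin 3),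
          ¬ ((∀ u ∈ hcpKissingPattern, ∃ z ∈ net k, dist (z - x) (dk • A u) ≤ dk / 8 + σ + 2 * τ) ∧
              (∀ z ∈ net k, z ≠ x → dist z x + σ + 4 * τ ≤ 13 / 10 * dk →
                ∃ u ∈ hcpKissingPattern, dist (z - x) (dk • A u) ≤ dk / 8 + σ + 2 * τ))))
    (hcv : ∀ k : ι, ∀ w : EuclideanSpace ℝ (Fin 3), ‖w‖ ≤ h + c → ∃ z ∈ net k, dist w z ≤ c - τ) (k : ι) :
    ¬ (∀ᵐ μ ∂P, ∀ p : EuclideanSpace ℝ (Fin 3), μ {p} ≠ 0 → Measure.map (fun z : EuclideanSpace ℝ (Fin 3) => z - p) μ ∈ coherentAt (net k) τ Rc) := by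
  intro hall
  refine not_ae_forall_reroot_mem_of_net hP hcore happr hτ h2τ hh hc hLRc hD hε0 hεδ hε7 hσ h4ε net good hG hB hcv ?_
  filter_upwards [hall] with μ hμ p hp using ⟨k, hμ p hp⟩

/-- ★ **THE NET ASSEMBLY: the crux BY NAME from a verdicted net and the defect-density ledger `hdef` alone.**  `hdef` is #56's second
hypothesis verbatim with `C δ := ⋃ k, coherentAt (net δ k) (τ δ) (Rc δ)`; `htex` of #56 is DISCHARGED by the LIFT (198). [folklore: junction] -/
theorem aperiodicFrustratedLawGap_of_net_and_defectDensity
    {ι : Type*} [Countable ι] (τ Rc D σ h c ε : ℝ → ℝ)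
    (hnum : ∀ δ : ℝ, 0 < δ → 0 ≤ τ δ ∧ 2 * τ δ < δ ∧ 0 < h δ ∧ 0 ≤ c δ ∧ h δ + 2 * c δ ≤ Rc δ ∧ 0 ≤ D δ ∧
      0 < ε δ ∧ 8 * ε δ < δ ∧ 8 * ε δ < 7 / 10 ∧ 0 < σ δ ∧ 4 * ε δ ≤ σ δ)
    (net : ℝ → ι → Finset (EuclideanSpace ℝ (Fin 3))) (good : ℝ → ι → Prop)
    (hG : ∀ δ : ℝ, 0 < δ → ∀ k : ι, good δ k → ∀ x ∈ net δ k, ‖x‖ ≤ h δ + 2 * c δ + τ δ →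
      ∃ (A : EuclideanSpace ℝ (Fin 3) →ₗᵢ[ℝ] EuclideanSpace ℝ (Fin 3)) (d₀ η₀ γ₀ : ℝ), 0 < d₀ ∧ 0 ≤ η₀ ∧
        (∀ z ∈ net δ k, z ≠ x → d₀ ≤ dist z x) ∧ (∃ z ∈ net δ k, z ≠ x ∧ dist z x ≤ d₀) ∧
        η₀ * d₀ + 4 * τ δ < 1 / 8 * (d₀ - 2 * τ δ) ∧ 46 / 10 * τ δ < γ₀ ∧ ‖x‖ + 13 / 10 * d₀ + γ₀ + 4 * τ δ ≤ Rc δ ∧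
        80 * ε δ ≤ d₀ - 34 * τ δ - 8 * (η₀ * d₀) ∧ 10 * ε δ ≤ γ₀ - 46 / 10 * τ δ ∧ 2 * d₀ + γ₀ + 2 ≤ D δ ∧
        ((∃ t₀ : ↥fccKissingPattern → EuclideanSpace ℝ (Fin 3),
            (∀ u : ↥fccKissingPattern, t₀ u ∈ net δ k ∧ ‖(t₀ u - x) - d₀ • A (u : EuclideanSpace ℝ (Fin 3))‖ ≤ η₀ * d₀) ∧
            (∀ z ∈ net δ k, z ≠ x → dist z x < 13 / 10 * d₀ + γ₀ → dist z x ≤ 13 / 10 * d₀ - γ₀ ∧ z ∈ Set.range t₀)) ∨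
         (∃ t₀ : ↥hcpKissingPattern → EuclideanSpace ℝ (Fin 3),
            (∀ u : ↥hcpKissingPattern, t₀ u ∈ net δ k ∧ ‖(t₀ u - x) - d₀ • A (u : EuclideanSpace ℝ (Fin 3))‖ ≤ η₀ * d₀) ∧
            (∀ z ∈ net δ k, z ≠ x → dist z x < 13 / 10 * d₀ + γ₀ → dist z x ≤ 13 / 10 * d₀ - γ₀ ∧ z ∈ Set.range t₀))))
    (hB : ∀ δ : ℝ, 0 < δ → ∀ k : ι, ¬ good δ k → (∀ z ∈ net δ k, ∀ z' ∈ net δ k, z ≠ z' → 2 * τ δ < dist z z') ∧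
      ∀ x ∈ net δ k, ‖x‖ ≤ h δ + 2 * c δ + τ δ → ∃ (z₁ : EuclideanSpace ℝ (Fin 3)) (d₁ : ℝ), z₁ ∈ net δ k ∧ z₁ ≠ x ∧ dist z₁ x ≤ d₁ ∧
        23 / 10 * (d₁ + 2 * τ δ + 2 * ε δ) + 1 ≤ D δ ∧ ‖x‖ + τ δ + 9 / 8 * (d₁ + 2 * τ δ + 2 * ε δ) + σ δ ≤ Rc δ ∧
        (∀ dk : ℝ, (7 : ℝ) / 10 ≤ dk → ∀ A : EuclideanSpace ℝ (Fin 3) →ₗᵢ[ℝ] EuclideanSpace ℝ (Fin 3),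
          ¬ ((∀ u ∈ fccKissingPattern, ∃ z ∈ net δ k, dist (z - x) (dk • A u) ≤ dk / 8 + σ δ + 2 * τ δ) ∧
              (∀ z ∈ net δ k, z ≠ x → dist z x + σ δ + 4 * τ δ ≤ 13 / 10 * dk →
                ∃ u ∈ fccKissingPattern, dist (z - x) (dk • A u) ≤ dk / 8 + σ δ + 2 * τ δ))) ∧
        (∀ dk : ℝ, (7 : ℝ) / 10 ≤ dk → ∀ A : EuclideanSpace ℝ (Fin 3) →ₗᵢ[ℝ] EuclideanSpace ℝ (Fin 3),
          ¬ ((∀ u ∈ hcpKissingPattern, ∃ z ∈ net δ k, dist (z - x) (dk • A u) ≤ dk / 8 + σ δ + 2 * τ δ) ∧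
              (∀ z ∈ net δ k, z ≠ x → dist z x + σ δ + 4 * τ δ ≤ 13 / 10 * dk →
                ∃ u ∈ hcpKissingPattern, dist (z - x) (dk • A u) ≤ dk / 8 + σ δ + 2 * τ δ))))
    (hcv : ∀ δ : ℝ, 0 < δ → ∀ k : ι, ∀ w : EuclideanSpace ℝ (Fin 3), ‖w‖ ≤ h δ + c δ → ∃ z ∈ net δ k, dist w z ≤ c δ - τ δ)
    (hdef : ∀ δ : ℝ, 0 < δ → ∀ P : MeasureTheory.Measure (MeasureTheory.Measure (EuclideanSpace ℝ (Fin 3))), let Gy : ℝ → (N : ℕ) → (Fin N → EuclideanSpace ℝ (Fin 3)) → Fin N → Prop := fun η N y j => let d : ℝ := sInf ((fun z => dist z (y (j : Fin N))) '' (Set.range (y) \ {(y (j : Fin N))})); let T : Set (EuclideanSpace ℝ (Fin 3)) := {z : EuclideanSpace ℝ (Fin 3) | z ∈ Set.range (y) ∧ z ≠ (y (j : Fin N)) ∧ dist z (y (j : Fin N)) < 13 / 10 * d}; ∃ A : EuclideanSpace ℝ (Fin 3) →ₗᵢ[ℝ] EuclideanSpace ℝ (Fin 3), (∃ e : ↥T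 ≃ ↥Literature.Geometry.DiscreteGeometry.fccKissingPattern, ∀ t : ↥T, dist (d⁻¹ • ((t : EuclideanSpace ℝ (Fin 3)) - (y (j : Fin N)))) (A ((e t : ↥Literature.Geometry.DiscreteGeometry.fccKissingPattern) : EuclideanSpace ℝ (Fin 3))) ≤ η) ∨ (∃ e : ↥T ≃ ↥Literature.Geometry.DiscreteGeometry.hcpKissingPattern, ∀ t : ↥T, dist (d⁻¹ • ((t : EuclideanSpace ℝ (Fin 3)) - (y (j : Fin N)))) (A ((e t : ↥Literature.Geometry.DiscreteGeometry.hcpKissingPattern) : EuclideanSpace ℝ (Fin 3))) ≤ η); let TexBall : (N : ℕ) → (Fin N → EuclideanSpace ℝ (Fin 3)) → Fin N → ℝ → ℝ → ℝ → ℝ → Prop := fun N y i R R₇ R₈ R₉ => (∀ a b : Fin N, a ≠ b → (7 : ℝ) / 10 ≤ dist (y a) (y b)) ∧ (∀ j : Fin N, dist (y j) (y i) ≤ R → ¬ Gy (1 / 20) N (y) j) ∧ (∀ j : Fin N, dist (y j) (y i) ≤ R → ¬ ((∀ j' : Fin N, dist (y j') (y j) ≤ R₇ → ¬ Gy (1 /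 20) N (y) j') ∧ (∀ z : EuclideanSpace ℝ (Fin 3), dist z (y j) ≤ R₇ → ∃ k : Fin N, dist z (y k) ≤ 1) ∧ (∀ j' : Fin N, dist (y j') (y j) ≤ R₇ → (let d : ℝ := sInf ((fun z => dist z (y j')) '' (Set.range (y) \ {(y j')})); ∀ k : Fin N, y k ≠ y j' → dist (y k) (y j') < 27 / 20 * d → 5 ≤ Nat.card {m : Fin N // y m ≠ y j' ∧ dist (y m) (y j') < 27 / 20 * d ∧ y m ≠ y k ∧ dist (y m) (y k) < 27 / 20 * d})))) ∧ (∀ j : Fin N, dist (y j) (y i) ≤ R → ∃ k : Fin N, dist (y k) (y j) ≤ R₈ ∧ Gy (1 / 8) N (y) k) ∧ (∀ j : Fin N, dist (y j) (y i) ≤ R → ¬ ((∀ j' : Fin N, dist (y j') (y j) ≤ R₉ → ¬ Gy (1 / 20) N (y) j') ∧ (Nat.card {j' : Fin N // dist (y j') (y j) ≤ R₉ ∧ ¬ Gy (1 / 8) N (y) j'} : ℝ) ≤ 1 / 2 * (Nat.card {j' : Fin N // dist (y j') (y j) ≤ R₉} : ℝ) ∧ (∀ j' : Fin N, dist (y j')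 (y j) ≤ R₉ → ¬ Gy (1 / 8) N (y) j' → ¬ (let d : ℝ := sInf ((fun z => dist z (y j')) '' (Set.range (y) \ {(y j')})); ∀ k : Fin N, y k ≠ y j' → dist (y k) (y j') < 27 / 20 * d → 5 ≤ Nat.card {m : Fin N // y m ≠ y j' ∧ dist (y m) (y j') < 27 / 20 * d ∧ y m ≠ y k ∧ dist (y m) (y k) < 27 / 20 * d})))); let Appr : MeasureTheory.Measure (EuclideanSpace ℝ (Fin 3)) → ℝ → ℝ → ℝ → Prop := fun μ R₇ R₈ R₉ => ∀ q : EuclideanSpace ℝ (Fin 3), μ {q} ≠ 0 → ∀ R ε : ℝ, 0 < ε → ∃ (N : ℕ) (y : Fin N → EuclideanSpace ℝ (Fin 3)) (i : Fin N), TexBall N y i R R₇ R₈ R₉ ∧ (∀ p : EuclideanSpace ℝ (Fin 3), μ {p} ≠ 0 → dist p q ≤ R → ∃ k : Fin N, dist (y k - y i) (p - q) ≤ ε) ∧ (∀ k : Fin N, dist (y k) (y i) ≤ R → ∃ p : EuclideanSpace ℝ (Fin 3), μ {p} ≠ 0 ∧ dist (y k - y i) (p - q) ≤ ε); MeasureTheory.IsProbabilityMeasure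 P → (∀ᵐ μ ∂P, Literature.Probability.Process.IsRootedHardCore δ μ) → Literature.Probability.Process.IsPointStationaryLaw P → (∃ R₇ R₈ R₉ : ℝ, ∀ᵐ μ ∂P, Appr μ R₇ R₈ R₉) → (∀ᵐ μ ∂P, ∀ p : EuclideanSpace ℝ (Fin 3), μ {p} ≠ 0 → ∀ y : EuclideanSpace ℝ (Fin 3), (∀ q : EuclideanSpace ℝ (Fin 3), μ {q} ≠ 0 → q ≠ p → y ≠ q) → ∑' q : {q : EuclideanSpace ℝ (Fin 3) // μ {q} ≠ 0 ∧ q ≠ p}, Literature.MathematicalPhysics.StatisticalMechanics.lennardJones (dist p (q : EuclideanSpace ℝ (Fin 3))) ≤ ∑' q : {q : EuclideanSpace ℝ (Fin 3) // μ {q} ≠ 0 ∧ q ≠ p}, Literature.MathematicalPhysics.StatisticalMechanics.lennardJones (dist y (q : EuclideanSpace ℝ (Fin 3)))) → P {μ : MeasureTheory.Measure (EuclideanSpace ℝ (Fin 3)) | ∃ Q : Literature.MathematicalPhysics.StatisticalMechanics.PeriodicConfiguration 3, ∃ t : EuclideanSpace ℝ (Fin 3), {p : EuclideanSpace ℝ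 (Fin 3) | μ {p} ≠ 0} = (fun s => s + t) '' Q.points} = 0 → (∀ A : Set (MeasureTheory.Measure (EuclideanSpace ℝ (Fin 3))), MeasurableSet A → (∀ μ : MeasureTheory.Measure (EuclideanSpace ℝ (Fin 3)), ∀ p : EuclideanSpace ℝ (Fin 3), μ {p} ≠ 0 → (μ ∈ A ↔ MeasureTheory.Measure.map (fun z : EuclideanSpace ℝ (Fin 3) => z - p) μ ∈ A)) → P A = 0 ∨ P Aᶜ = 0) → (∫ μ, Literature.MathematicalPhysics.StatisticalMechanics.rootEnergy Literature.MathematicalPhysics.StatisticalMechanics.lennardJones μ ∂P) ≤ (⨅ Q : Literature.MathematicalPhysics.StatisticalMechanics.PeriodicConfiguration 3, Q.energyPerParticle Literature.MathematicalPhysics.StatisticalMechanics.lennardJones) → 0 < P.real (⋃ k : ι, FrustratedLawDichotomyCoherentSets.coherentAt (net δ k) (τ δ) (Rc δ))ᶜ → Nonempty (LawLedger P (⨅ Q : Literature.MathematicalPhysics.StatisticalMechanics.PeriodicConfiguration 3, Q.energyPerParticle Literature.MathematicalPhysics.StatisticalMechanics.lennardJones))) :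
    Summit.AtomisticToContinuum.Crystallization.Theses.FrustratedLawDichotomy.AperiodicFrustratedLawGap := by
  refine aperiodicFrustratedLawGap_of_texture_and_defectDensity
    (fun δ => ⋃ k : ι, coherentAt (net δ k) (τ δ) (Rc δ))
    (fun δ => measurableSet_iUnion_coherentAt (net δ) (fun _ => τ δ) (fun _ => Rc δ)) ?_ hdef
  intro δ hδ P
  dsimp only
  intro _hP ha _hb hd _he _h0 _herg _hmin
  obtain ⟨R₇, R₈, R₉, happr⟩ := hd
  have happr' : ∀ᵐ μ ∂P, ApprM μ R₇ R₈ R₉ := happr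
  obtain ⟨hτ, h2τ, hh, hc, hLRc, hD, hε0, hεδ, hε7, hσ, h4ε⟩ := hnum δ hδ
  exact ae_exists_incoherent_reroot_of_net ha happr' hτ h2τ hh hc hLRc hD hε0 hεδ hε7 hσ h4ε (net δ) (good δ) (hG δ hδ) (hB δ hδ)
    (hcv δ hδ)

/-- ★ The `PeriodicChargeSplit` copy of the net assembly. [folklore: junction] -/
theorem periodicChargeSplit_aperiodicFrustratedLawGap_of_net_and_defectDensity
    {ι : Type*} [Countable ι] (τ Rc D σ h c ε : ℝ → ℝ)
    (hnum : ∀ δ : ℝ, 0 < δ → 0 ≤ τ δ ∧ 2 * τ δ < δ ∧ 0 < h δ ∧ 0 ≤ c δ ∧ h δ + 2 * c δ ≤ Rc δ ∧ 0 ≤ D δ ∧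
      0 < ε δ ∧ 8 * ε δ < δ ∧ 8 * ε δ < 7 / 10 ∧ 0 < σ δ ∧ 4 * ε δ ≤ σ δ)
    (net : ℝ → ι → Finset (EuclideanSpace ℝ (Fin 3))) (good : ℝ → ι → Prop)
    (hG : ∀ δ : ℝ, 0 < δ → ∀ k : ι, good δ k → ∀ x ∈ net δ k, ‖x‖ ≤ h δ + 2 * c δ + τ δ →
      ∃ (A : EuclideanSpace ℝ (Fin 3) →ₗᵢ[ℝ] EuclideanSpace ℝ (Fin 3)) (d₀ η₀ γ₀ : ℝ), 0 < d₀ ∧ 0 ≤ η₀ ∧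
        (∀ z ∈ net δ k, z ≠ x → d₀ ≤ dist z x) ∧ (∃ z ∈ net δ k, z ≠ x ∧ dist z x ≤ d₀) ∧
        η₀ * d₀ + 4 * τ δ < 1 / 8 * (d₀ - 2 * τ δ) ∧ 46 / 10 * τ δ < γ₀ ∧ ‖x‖ + 13 / 10 * d₀ + γ₀ + 4 * τ δ ≤ Rc δ ∧
        80 * ε δ ≤ d₀ - 34 * τ δ - 8 * (η₀ * d₀) ∧ 10 * ε δ ≤ γ₀ - 46 / 10 * τ δ ∧ 2 * d₀ + γ₀ + 2 ≤ D δ ∧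
        ((∃ t₀ : ↥fccKissingPattern → EuclideanSpace ℝ (Fin 3),
            (∀ u : ↥fccKissingPattern, t₀ u ∈ net δ k ∧ ‖(t₀ u - x) - d₀ • A (u : EuclideanSpace ℝ (Fin 3))‖ ≤ η₀ * d₀) ∧
            (∀ z ∈ net δ k, z ≠ x → dist z x < 13 / 10 * d₀ + γ₀ → dist z x ≤ 13 / 10 * d₀ - γ₀ ∧ z ∈ Set.range t₀)) ∨
         (∃ t₀ : ↥hcpKissingPattern → EuclideanSpace ℝ (Fin 3),
            (∀ u : ↥hcpKissingPattern, t₀ u ∈ net δ k ∧ ‖(t₀ u - x) - d₀ • A (u : EuclideanSpace ℝ (Fin 3))‖ ≤ η₀ * d₀) ∧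
            (∀ z ∈ net δ k, z ≠ x → dist z x < 13 / 10 * d₀ + γ₀ → dist z x ≤ 13 / 10 * d₀ - γ₀ ∧ z ∈ Set.range t₀))))
    (hB : ∀ δ : ℝ, 0 < δ → ∀ k : ι, ¬ good δ k → (∀ z ∈ net δ k, ∀ z' ∈ net δ k, z ≠ z' → 2 * τ δ < dist z z') ∧
      ∀ x ∈ net δ k, ‖x‖ ≤ h δ + 2 * c δ + τ δ → ∃ (z₁ : EuclideanSpace ℝ (Fin 3)) (d₁ : ℝ), z₁ ∈ net δ k ∧ z₁ ≠ x ∧ dist z₁ x ≤ d₁ ∧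
        23 / 10 * (d₁ + 2 * τ δ + 2 * ε δ) + 1 ≤ D δ ∧ ‖x‖ + τ δ + 9 / 8 * (d₁ + 2 * τ δ + 2 * ε δ) + σ δ ≤ Rc δ ∧
        (∀ dk : ℝ, (7 : ℝ) / 10 ≤ dk → ∀ A : EuclideanSpace ℝ (Fin 3) →ₗᵢ[ℝ] EuclideanSpace ℝ (Fin 3),
          ¬ ((∀ u ∈ fccKissingPattern, ∃ z ∈ net δ k, dist (z - x) (dk • A u) ≤ dk / 8 + σ δ + 2 * τ δ) ∧
              (∀ z ∈ net δ k, z ≠ x → dist z x + σ δ + 4 * τ δ ≤ 13 / 10 * dk →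
                ∃ u ∈ fccKissingPattern, dist (z - x) (dk • A u) ≤ dk / 8 + σ δ + 2 * τ δ))) ∧
        (∀ dk : ℝ, (7 : ℝ) / 10 ≤ dk → ∀ A : EuclideanSpace ℝ (Fin 3) →ₗᵢ[ℝ] EuclideanSpace ℝ (Fin 3),
          ¬ ((∀ u ∈ hcpKissingPattern, ∃ z ∈ net δ k, dist (z - x) (dk • A u) ≤ dk / 8 + σ δ + 2 * τ δ) ∧
              (∀ z ∈ net δ k, z ≠ x → dist z x + σ δ + 4 * τ δ ≤ 13 / 10 * dk →
                ∃ u ∈ hcpKissingPattern, dist (z - x) (dk • A u) ≤ dk / 8 + σ δ + 2 * τ δ))))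
    (hcv : ∀ δ : ℝ, 0 < δ → ∀ k : ι, ∀ w : EuclideanSpace ℝ (Fin 3), ‖w‖ ≤ h δ + c δ → ∃ z ∈ net δ k, dist w z ≤ c δ - τ δ)
    (hdef : ∀ δ : ℝ, 0 < δ → ∀ P : MeasureTheory.Measure (MeasureTheory.Measure (EuclideanSpace ℝ (Fin 3))), let Gy : ℝ → (N : ℕ) → (Fin N → EuclideanSpace ℝ (Fin 3)) → Fin N → Prop := fun η N y j => let d : ℝ := sInf ((fun z => dist z (y (j : Fin N))) '' (Set.range (y) \ {(y (j : Fin N))})); let T : Set (EuclideanSpace ℝ (Fin 3)) := {z : EuclideanSpace ℝ (Fin 3) | z ∈ Set.range (y) ∧ z ≠ (y (j : Fin N)) ∧ dist z (y (j : Fin N)) < 13 / 10 * d}; ∃ A : EuclideanSpace ℝ (Fin 3) →ₗᵢ[ℝ] EuclideanSpace ℝ (Fin 3), (∃ e : ↥T ≃ ↥Literature.Geometry.DiscreteGeometry.fccKissingPattern, ∀ t : ↥T, dist (d⁻¹ • ((t : EuclideanSpace ℝ (Fin 3)) - (y (j : Fin N)))) (A ((e t : ↥Literature.Geometry.DiscreteGeometry.fccKissingPattern)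 : EuclideanSpace ℝ (Fin 3))) ≤ η) ∨ (∃ e : ↥T ≃ ↥Literature.Geometry.DiscreteGeometry.hcpKissingPattern, ∀ t : ↥T, dist (d⁻¹ • ((t : EuclideanSpace ℝ (Fin 3)) - (y (j : Fin N)))) (A ((e t : ↥Literature.Geometry.DiscreteGeometry.hcpKissingPattern) : EuclideanSpace ℝ (Fin 3))) ≤ η); let TexBall : (N : ℕ) → (Fin N → EuclideanSpace ℝ (Fin 3)) → Fin N → ℝ → ℝ → ℝ → ℝ → Prop := fun N y i R R₇ R₈ R₉ => (∀ a b : Fin N, a ≠ b → (7 : ℝ) / 10 ≤ dist (y a) (y b)) ∧ (∀ j : Fin N, dist (y j) (y i) ≤ R → ¬ Gy (1 / 20) N (y) j) ∧ (∀ j : Fin N, dist (y j) (y i) ≤ R → ¬ ((∀ j' : Fin N, dist (y j') (y j) ≤ R₇ → ¬ Gy (1 / 20) N (y) j') ∧ (∀ z : EuclideanSpace ℝ (Fin 3), dist z (y j) ≤ R₇ → ∃ k : Fin N, dist z (y k) ≤ 1) ∧ (∀ j' : Fin N, dist (y j') (y j) ≤ R₇ → (let d : ℝ := sInf ((fun z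 => dist z (y j')) '' (Set.range (y) \ {(y j')})); ∀ k : Fin N, y k ≠ y j' → dist (y k) (y j') < 27 / 20 * d → 5 ≤ Nat.card {m : Fin N // y m ≠ y j' ∧ dist (y m) (y j') < 27 / 20 * d ∧ y m ≠ y k ∧ dist (y m) (y k) < 27 / 20 * d})))) ∧ (∀ j : Fin N, dist (y j) (y i) ≤ R → ∃ k : Fin N, dist (y k) (y j) ≤ R₈ ∧ Gy (1 / 8) N (y) k) ∧ (∀ j : Fin N, dist (y j) (y i) ≤ R → ¬ ((∀ j' : Fin N, dist (y j') (y j) ≤ R₉ → ¬ Gy (1 / 20) N (y) j') ∧ (Nat.card {j' : Fin N // dist (y j') (y j) ≤ R₉ ∧ ¬ Gy (1 / 8) N (y) j'} : ℝ) ≤ 1 / 2 * (Nat.card {j' : Fin N // dist (y j') (y j) ≤ R₉} : ℝ) ∧ (∀ j' : Fin N, dist (y j') (y j) ≤ R₉ → ¬ Gy (1 / 8) N (y) j' → ¬ (let d : ℝ := sInf ((fun z => dist z (y j')) '' (Set.range (y) \ {(y j')})); ∀ k : Fin N, y k ≠ y j' → dist (y k) (y j') < 27 / 20 * d → 5 ≤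 Nat.card {m : Fin N // y m ≠ y j' ∧ dist (y m) (y j') < 27 / 20 * d ∧ y m ≠ y k ∧ dist (y m) (y k) < 27 / 20 * d})))); let Appr : MeasureTheory.Measure (EuclideanSpace ℝ (Fin 3)) → ℝ → ℝ → ℝ → Prop := fun μ R₇ R₈ R₉ => ∀ q : EuclideanSpace ℝ (Fin 3), μ {q} ≠ 0 → ∀ R ε : ℝ, 0 < ε → ∃ (N : ℕ) (y : Fin N → EuclideanSpace ℝ (Fin 3)) (i : Fin N), TexBall N y i R R₇ R₈ R₉ ∧ (∀ p : EuclideanSpace ℝ (Fin 3), μ {p} ≠ 0 → dist p q ≤ R → ∃ k : Fin N, dist (y k - y i) (p - q) ≤ ε) ∧ (∀ k : Fin N, dist (y k) (y i) ≤ R → ∃ p : EuclideanSpace ℝ (Fin 3), μ {p} ≠ 0 ∧ dist (y k - y i) (p - q) ≤ ε); MeasureTheory.IsProbabilityMeasure P → (∀ᵐ μ ∂P, Literature.Probability.Process.IsRootedHardCore δ μ) → Literature.Probability.Process.IsPointStationaryLaw P → (∃ R₇ R₈ R₉ : ℝ, ∀ᵐ μ ∂P, Appr μ R₇ R₈ R₉)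 → (∀ᵐ μ ∂P, ∀ p : EuclideanSpace ℝ (Fin 3), μ {p} ≠ 0 → ∀ y : EuclideanSpace ℝ (Fin 3), (∀ q : EuclideanSpace ℝ (Fin 3), μ {q} ≠ 0 → q ≠ p → y ≠ q) → ∑' q : {q : EuclideanSpace ℝ (Fin 3) // μ {q} ≠ 0 ∧ q ≠ p}, Literature.MathematicalPhysics.StatisticalMechanics.lennardJones (dist p (q : EuclideanSpace ℝ (Fin 3))) ≤ ∑' q : {q : EuclideanSpace ℝ (Fin 3) // μ {q} ≠ 0 ∧ q ≠ p}, Literature.MathematicalPhysics.StatisticalMechanics.lennardJones (dist y (q : EuclideanSpace ℝ (Fin 3)))) → P {μ : MeasureTheory.Measure (EuclideanSpace ℝ (Fin 3)) | ∃ Q : Literature.MathematicalPhysics.StatisticalMechanics.PeriodicConfiguration 3, ∃ t : EuclideanSpace ℝ (Fin 3), {p : EuclideanSpace ℝ (Fin 3) | μ {p} ≠ 0} = (fun s => s + t) '' Q.points} = 0 → (∀ A : Set (MeasureTheory.Measure (EuclideanSpace ℝ (Fin 3))), MeasurableSet A → (∀ μ : MeasureTheory.Measure (EuclideanSpace ℝ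 (Fin 3)), ∀ p : EuclideanSpace ℝ (Fin 3), μ {p} ≠ 0 → (μ ∈ A ↔ MeasureTheory.Measure.map (fun z : EuclideanSpace ℝ (Fin 3) => z - p) μ ∈ A)) → P A = 0 ∨ P Aᶜ = 0) → (∫ μ, Literature.MathematicalPhysics.StatisticalMechanics.rootEnergy Literature.MathematicalPhysics.StatisticalMechanics.lennardJones μ ∂P) ≤ (⨅ Q : Literature.MathematicalPhysics.StatisticalMechanics.PeriodicConfiguration 3, Q.energyPerParticle Literature.MathematicalPhysics.StatisticalMechanics.lennardJones) → 0 < P.real (⋃ k : ι, FrustratedLawDichotomyCoherentSets.coherentAt (net δ k) (τ δ) (Rc δ))ᶜ → Nonempty (LawLedger P (⨅ Q : Literature.MathematicalPhysics.StatisticalMechanics.PeriodicConfiguration 3, Q.energyPerParticle Literature.MathematicalPhysics.StatisticalMechanics.lennardJones))) :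
    Summit.AtomisticToContinuum.Crystallization.Theses.PeriodicChargeSplit.AperiodicFrustratedLawGap := by
  refine periodicChargeSplit_aperiodicFrustratedLawGap_of_texture_and_defectDensity
    (fun δ => ⋃ k : ι, coherentAt (net δ k) (τ δ) (Rc δ))
    (fun δ => measurableSet_iUnion_coherentAt (net δ) (fun _ => τ δ) (fun _ => Rc δ)) ?_ hdef
  intro δ hδ P
  dsimp only
  intro _hP ha _hb hd _he _h0 _herg _hmin
  obtain ⟨R₇, R₈, R₉, happr⟩ := hd
  have happr' : ∀ᵐ μ ∂P, ApprM μ R₇ R₈ R₉ := happr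
  obtain ⟨hτ, h2τ, hh, hc, hLRc, hD, hε0, hεδ, hε7, hσ, h4ε⟩ := hnum δ hδ
  exact ae_exists_incoherent_reroot_of_net ha happr' hτ h2τ hh hc hLRc hD hε0 hεδ hε7 hσ h4ε (net δ) (good δ) (hG δ hδ) (hB δ hδ)
    (hcv δ hδ)

end Summit.AtomisticToContinuum.Crystallization.Theorems.FrustratedLawDichotomyTextureNetAssembly

end
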